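import Literature.AlgebraicGeometry.Villamayor2007.ElimAlgebraIntegralOverH
import Mathlib.Data.Nat.Choose.Dvd
import Mathlib.Data.Nat.Multiplicity
import HarnessLib

/-!
# Villamayor 2007, Def. 1.42 / Thm. 1.16 (i) / Example 6.10 for the PURELY INSEPARABLE specimens `Z^{p^n} + c` in
# characteristic `p`: the one-polynomial elimination algebras `ℋ_f` and `R̄_f` are TRIVIAL — PROVED

O. E. Villamayor U., *Hypersurface singularities in positive characteristic*, Adv. Math. **213** (2007) 687–733
= arXiv:math/0606796 [Villamayor2007]: 1.1 p0006 L30–L39, Thm. 1.16 (i) p0009 L55–L64, Def. 1.21 p0010 L50–L53,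
Def. 1.42 p0014 L16–L64, Example 6.10 p0031 L26–L48. Locators «p00NN Lnn» = chunk · line of the held arXiv text
(`lit read paper:arxiv-math_0606796`; p0006, p0009, p0031 re-read before typing). Campaign `res-hironaka`
(D-0089), ladder rung LIT-6. PROOF file: theorems only, NO definitions, NO named facts; nothing of Hironaka's
2017 manuscript is referred to or asserted. Sequel of `HElimAlgebraGenerators.lean` ((1.42.3): `ℋ_f` = the
weighted coefficient algebra of the `ψ_{Δ^e f}`) and `ElimAlgebraIntegralOverH.lean` ((1.42.4): `R̄_f` integral
over `ℋ_f`).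

These are COROLLARIES (ours, labelled as such) of the printed Def. 1.21 / Def. 1.42 / (1.42.4) for the specimens
`f = Z^d + c` whose middle binomial coefficients `binom(d, e)`, `0 < e < d`, vanish in `S` — in characteristic `p`:
`d = p` and `d = p^n` (the purely inseparable hypersurfaces `Z^p + c`, `Z^{p^n} + c`, e.g. Example 6.10's
`Z² + Y⁵` in characteristic `2`, p0031 L40–L41 «This is a purely inseparable extension»). They make precise, in the
kernel, WHY the information used in Example 6.10 comes from the Diff-algebra element `Y⁴W` (p0031 L33–L35 «the
Diff-algebra generated by `(Z²+Y⁵)W²` … is generated by `{Y⁴W, (Z²+Y⁵)W²}`»; the characteristic polynomial of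
multiplication by `Y⁴`, `MultiplicationCharpoly.mulCharpolyRees_cusp_charTwo`) and NOT from `f` itself:

* `hasseDeriv_X_pow_add_C_eq_zero` — `Δ^e(Z^d + c) = binom(d,e)·Z^{d−e} = 0` for `0 < e < d` under the vanishing
  hypothesis (`cast_choose_char_eq_zero`, `cast_choose_char_pow_eq_zero`: `p ∣ binom(p,e)`, `p ∣ binom(p^n,e)`).
* `hElimAlgebra_X_pow_add_C_eq_bot` (`…_char_…`, `…_char_pow_…`) — **`ℋ_f = ⊥`** (the constants `S ⊂ S[W]`): by
  (1.42.3) in closed form (`hElimAlgebra_coeffVec_eq_mulCharpolyReesOfFamily`) `ℋ_f` is generated by the weighted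
  coefficients of the characteristic polynomials of multiplication by the `Δ^e(f) = 0`, i.e. of `ψ_0 = T^d`
  (`mulCharpoly_zero`), all of which vanish in positive weight.
* `isIntegral_of_mem_elimAlgebra_X_pow_add_C` — hence, by (1.42.4) (`isIntegral_of_mem_elimAlgebra`), **every element
  of `R̄_f ⊂ S[W]` is integral over `S`** itself.
* `isNilpotent_of_isIntegral_monomial` / `eq_zero_of_isIntegral_monomial` — an element `h·W^r` (`r ≥ 1`) of `S[W]`
  integral over `S` has `h` nilpotent (compare the coefficients of `W^{r·m}` in a monic equation); so
* `elimIdeal_X_pow_add_C_eq_bot`, `elimAlgebra_X_pow_add_C_eq_bot` (+ `char` instances) — **over a REDUCED `S` of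
  characteristic `p`, `I_r(Z^{p^n} + c) = 0` for every `r ≥ 1` and `R̄_{Z^{p^n}+c} = ⊥`**: the generalized
  discriminants (p0004 L93–L102) of a purely inseparable equation all vanish — the instance of Thm. 1.16 (i) p0009
  L55–L64 («`V(⟨G_{b,1}(a),…,G_{b,r_b}(a)⟩)` is the set of points in `Spec(R)` where the finite morphism is purely
  ramified») in which EVERY point is purely ramified (1.1 p0006 L35–L39: «the class of `f(Z)` in `k(P)̄[Z]` has a
  unique root» — here `Z^{p^n} + c = (Z + γ)^{p^n}`), so that `V(I_r) = Spec(S)`, i.e. `I_r ⊆ nilradical = 0`.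
* NOT claimed: anything about the elimination algebra `R_𝒢` of the DIFF-ALGEBRA `𝒢 ∋ Y⁴W` of Example 6.10 beyond
  `MultiplicationCharpoly.mulCharpolyRees_cusp_charTwo` / `mulCharpolyRees_C_of_charP` (the coefficient algebra of a
  degree-one member `c·W`), nor non-reduced `S`. Scope: any commutative `k`; `S` any commutative `k`-algebra with the
  stated hypotheses.

## References

* O. E. Villamayor U., Adv. Math. 213 (2007) 687–733 = arXiv:math/0606796: 1.1, Thm. 1.16 (i), Def. 1.21, Def. 1.42,
  Example 6.10. [Villamayor2007]
-/

noncomputable section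

open scoped Polynomial

namespace Literature.AlgebraicGeometry.Villamayor2007

open MvPolynomial

universe u v w

/-! ## Integral elements `h·W^r` of `S[W]` over `S` -/

section IntegralMonomial

variable {S : Type w} [CommRing S]

/-- **Integral monomials have nilpotent coefficients**: if `h·W^r ∈ S[W]`, `r ≥ 1`, is integral over `S`, then `h` is
nilpotent — in a monic equation `(hW^r)^m + Σ_{i<m} s_i (hW^r)^i = 0` the coefficient of `W^{rm}` is `h^m`. (Elementary;
the form in which Thm. 1.16 (i) is read below: an ideal `I_r`, `r ≥ 1`, whose members `h` have `h·W^r` integral over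
`S` is nil.) [cite: Villamayor2007, Thm. 1.16 (i) p0009 L55–L64] -/
theorem isNilpotent_of_isIntegral_monomial {r : ℕ} (hr : 1 ≤ r) {h : S}
    (hint : IsIntegral S (Polynomial.monomial r h : S[X])) : IsNilpotent h := by
  obtain ⟨P, hP, hPh⟩ := hint
  refine ⟨P.natDegree, ?_⟩
  have hcoeff := congrArg (fun q : S[X] => q.coeff (r * P.natDegree)) hPh
  simp only [Polynomial.coeff_zero] at hcoeff
  rw [Polynomial.eval₂_eq_sum_range, Polynomial.finsetSum_coeff] at hcoeff
  have key : ∀ i ∈ Finset.range (P.natDegree + 1),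
      ((algebraMap S S[X]) (P.coeff i) * Polynomial.monomial r h ^ i).coeff (r * P.natDegree) =
        if i = P.natDegree then h ^ P.natDegree else 0 := by
    intro i _
    rw [Polynomial.algebraMap_eq, Polynomial.monomial_pow, Polynomial.C_mul_monomial, Polynomial.coeff_monomial]
    by_cases hi : i = P.natDegree
    · subst hi
      rw [if_pos rfl, if_pos rfl, hP.coeff_natDegree, one_mul]
    · rw [if_neg hi, if_neg]
      intro h'
      exact hi (Nat.eq_of_mul_eq_mul_left (by omega) h')
  rw [Finset.sum_congr rfl key, Finset.sum_ite_eq', if_pos (by simp)] at hcoeff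
  exact hcoeff

/-- Over a reduced `S`: `h·W^r` (`r ≥ 1`) integral over `S` forces `h = 0`. [cite: Villamayor2007, Thm. 1.16 (i) p0009 L55–L64] -/
theorem eq_zero_of_isIntegral_monomial [IsReduced S] {r : ℕ} (hr : 1 ≤ r) {h : S}
    (hint : IsIntegral S (Polynomial.monomial r h : S[X])) : h = 0 :=
  (isNilpotent_of_isIntegral_monomial hr hint).eq_zero

end IntegralMonomial

/-! ## `f = Z^d + c` with `binom(d, e) = 0` in `S` for `0 < e < d`: all Hasse derivatives vanish -/

section VanishingBinomials

variable (k : Type v) [CommRing k] {S : Type w} [CommRing S] [Algebra k S] {d : ℕ}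

/-- `Δ^e(Z^d + c) = binom(d, e)·Z^{d−e} = 0` for `0 < e < d` when the binomial coefficients `binom(d,e)` vanish in `S`
(Def. 1.2 p0006 L54–L65: `Δ^e` = Hasse derivative; e.g. `d = p^n` in characteristic `p`). [cite: Villamayor2007, Def. 1.2 p0006 L54–L65] -/
theorem hasseDeriv_X_pow_add_C_eq_zero (hd : ∀ e : ℕ, 1 ≤ e → e + 1 ≤ d → ((d.choose e : ℕ) : S) = 0)
    (c : S) {e : ℕ} (he1 : 1 ≤ e) (he : e + 1 ≤ d) :
    Polynomial.hasseDeriv e (Polynomial.X ^ d + Polynomial.C c : S[X]) = 0 := by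
  rw [map_add, Polynomial.hasseDeriv_C e c (by omega), add_zero, Polynomial.X_pow_eq_monomial,
    Polynomial.hasseDeriv_monomial, hd e he1 he, zero_mul, Polynomial.monomial_zero_right]

/-- **`ℋ_{Z^d + c} = ⊥` when all `binom(d,e)`, `0 < e < d`, vanish in `S`** (COROLLARY, ours, of Def. 1.21 / Def. 1.42
(1.42.3) p0014 L47–L54 in the closed form `HElimAlgebraGenerators.hElimAlgebra_coeffVec_eq_mulCharpolyReesOfFamily`):
the generators are the positive-weight coefficients of the characteristic polynomials of multiplication by
`Δ^e(f) = 0`, i.e. of `ψ_0 = T^d`, which vanish. [cite: Villamayor2007, Def. 1.42 (1.42.3) p0014 L47–L54] -/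
theorem hElimAlgebra_X_pow_add_C_eq_bot (hd : ∀ e : ℕ, 1 ≤ e → e + 1 ≤ d → ((d.choose e : ℕ) : S) = 0)
    (hd0 : d ≠ 0) (c : S) :
    hElimAlgebra k (coeffVec d (Polynomial.X ^ d + Polynomial.C c : S[X])) = ⊥ := by
  refine le_antisymm ?_ bot_le
  rcases subsingleton_or_nontrivial S with hS | hS
  · intro q _
    rw [Subsingleton.elim q 0]
    exact zero_mem _
  rw [hElimAlgebra_coeffVec_eq_mulCharpolyReesOfFamily k (Polynomial.monic_X_pow_add_C c hd0)
    (Polynomial.natDegree_X_pow_add_C (n := d) (r := c))]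
  unfold mulCharpolyReesOfFamily
  refine iSup₂_le fun gn hgn => ?_
  obtain ⟨e, he1, he, rfl⟩ := hgn
  dsimp only
  rw [hasseDeriv_X_pow_add_C_eq_zero hd c he1 he]
  unfold mulCharpolyRees
  refine Algebra.adjoin_le ?_
  rintro _ ⟨j, hj1, hj, rfl⟩
  rw [Polynomial.natDegree_X_pow_add_C] at hj ⊢
  rw [mulCharpoly_zero, Polynomial.natDegree_X_pow_add_C, Polynomial.coeff_X_pow, if_neg (by omega),
    map_zero]
  exact zero_mem _

/-- Hence (Def. 1.42 (1.42.4) p0014 L56–L60 «`ℋ_f ⊂ R̄_f` … finite», `ElimAlgebraIntegralOverH.isIntegral_of_mem_elimAlgebra`):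
for such `f = Z^d + c`, every element of the elimination algebra `R̄_f ⊂ S[W]` is integral over `S`.
[cite: Villamayor2007, Def. 1.42 (1.42.4) p0014 L56–L60] -/
theorem isIntegral_of_mem_elimAlgebra_X_pow_add_C
    (hd : ∀ e : ℕ, 1 ≤ e → e + 1 ≤ d → ((d.choose e : ℕ) : S) = 0) (hd0 : d ≠ 0) (c : S) {q : S[X]}
    (hq : q ∈ elimAlgebra k (coeffVec d (Polynomial.X ^ d + Polynomial.C c : S[X]))) : IsIntegral S q := by
  have h := isIntegral_of_mem_elimAlgebra k (coeffVec d (Polynomial.X ^ d + Polynomial.C c : S[X])) hq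
  rw [hElimAlgebra_X_pow_add_C_eq_bot k hd hd0 c] at h
  haveI : Algebra.IsIntegral S (⊥ : Subalgebra S S[X]) := ⟨fun x => by
    obtain ⟨s, hs⟩ := Algebra.mem_bot.mp x.2
    have hx : x = algebraMap S (⊥ : Subalgebra S S[X]) s := Subtype.ext hs.symm
    rw [hx]
    exact isIntegral_algebraMap⟩
  exact isIntegral_trans q h

/-- **All generalized discriminants of `Z^d + c` vanish over a reduced `S`** (when the `binom(d,e)`, `0 < e < d`, vanish
in `S`): `I_r(f) = 0` for `r ≥ 1` — the instance of Thm. 1.16 (i) p0009 L55–L64 «`V(⟨G_{b,1}(a_1,…,a_b),…,G_{b,r_b}(a_1,…,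
a_b)⟩)` is the set of points in `Spec(R)` where the finite morphism is purely ramified» in which every point is
purely ramified (COROLLARY, ours, through `isIntegral_of_mem_elimAlgebra_X_pow_add_C` and
`eq_zero_of_isIntegral_monomial`, not through Thm. 1.16 itself). [cite: Villamayor2007, Thm. 1.16 (i) p0009 L55–L64] -/
theorem elimIdeal_X_pow_add_C_eq_bot [IsReduced S]
    (hd : ∀ e : ℕ, 1 ≤ e → e + 1 ≤ d → ((d.choose e : ℕ) : S) = 0) (hd0 : d ≠ 0) (c : S) {r : ℕ} (hr : 1 ≤ r) :
    elimIdeal k (coeffVec d (Polynomial.X ^ d + Polynomial.C c : S[X])) r = ⊥ := by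
  refine (Submodule.eq_bot_iff _).mpr fun h hh => ?_
  have hmem := monomial_mem_elimAlgebra (coeffVec d (Polynomial.X ^ d + Polynomial.C c : S[X])) hh
  exact eq_zero_of_isIntegral_monomial hr (isIntegral_of_mem_elimAlgebra_X_pow_add_C k hd hd0 c hmem)

/-- `R̄_{Z^d + c} = ⊥ ⊂ S[W]` over a reduced `S` in which the `binom(d,e)`, `0 < e < d`, vanish.
[cite: Villamayor2007, Thm. 1.16 (i) p0009 L55–L64] -/
theorem elimAlgebra_X_pow_add_C_eq_bot [IsReduced S]
    (hd : ∀ e : ℕ, 1 ≤ e → e + 1 ≤ d → ((d.choose e : ℕ) : S) = 0) (hd0 : d ≠ 0) (c : S) :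
    elimAlgebra k (coeffVec d (Polynomial.X ^ d + Polynomial.C c : S[X])) = ⊥ := by
  refine le_antisymm ?_ bot_le
  unfold elimAlgebra reesOfFamily
  refine Algebra.adjoin_le ?_
  rintro _ ⟨n, c', hc', rfl⟩
  rcases Nat.eq_zero_or_pos n with rfl | hn
  · rw [Polynomial.monomial_zero_left]
    exact Subalgebra.algebraMap_mem _ c'
  · rw [elimIdeal_X_pow_add_C_eq_bot k hd hd0 c hn, Ideal.mem_bot] at hc'
    rw [hc', map_zero]
    exact zero_mem _

end VanishingBinomials

/-! ## Characteristic `p`: the purely inseparable specimens `Z^p + c` and `Z^{p^n} + c` -/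

section CharP

variable (k : Type v) [CommRing k] {S : Type w} [CommRing S] [Algebra k S] (p : ℕ) [Fact p.Prime] [CharP S p]

/-- `binom(p, e) = 0` in characteristic `p` for `0 < e < p`. [cite: Villamayor2007, Example 6.10 p0031 L40–L41] -/
theorem cast_choose_char_eq_zero {e : ℕ} (he1 : 1 ≤ e) (he : e + 1 ≤ p) : ((p.choose e : ℕ) : S) = 0 := by
  rw [CharP.cast_eq_zero_iff S p]
  exact Nat.Prime.dvd_choose_self (Fact.out : p.Prime) (by omega) (by omega)

/-- `binom(p^n, e) = 0` in characteristic `p` for `0 < e < p^n`. [cite: Villamayor2007, Example 6.10 p0031 L40–L41] -/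
theorem cast_choose_char_pow_eq_zero (n : ℕ) {e : ℕ} (he1 : 1 ≤ e) (he : e + 1 ≤ p ^ n) :
    (((p ^ n).choose e : ℕ) : S) = 0 := by
  rw [CharP.cast_eq_zero_iff S p]
  exact Nat.Prime.dvd_choose_pow (Fact.out : p.Prime) (by omega) (by omega)

/-- **`ℋ_{Z^p + c} = ⊥` in characteristic `p`** — the purely inseparable specimen of Example 6.10 p0031 L40–L41 («`f_{c_1}
= Z² + Y⁵`. This is a purely inseparable extension»): the one-polynomial computable elimination algebra carries no
information; Example 6.10's data `Y⁸W²` come from the Diff-algebra element `Y⁴W` (p0031 L33–L35,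
`MultiplicationCharpoly.mulCharpolyRees_cusp_charTwo`), not from `f`. (COROLLARY, ours.)
[cite: Villamayor2007, Example 6.10 p0031 L26–L48] -/
theorem hElimAlgebra_X_pow_char_add_C_eq_bot (c : S) :
    hElimAlgebra k (coeffVec p (Polynomial.X ^ p + Polynomial.C c : S[X])) = ⊥ :=
  hElimAlgebra_X_pow_add_C_eq_bot k (fun _ he1 he => cast_choose_char_eq_zero p he1 he)
    (Fact.out : p.Prime).ne_zero c

/-- `ℋ_{Z^{p^n} + c} = ⊥` in characteristic `p` (every `n`; `n = 0` is the trivial degree-one case).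
[cite: Villamayor2007, Example 6.10 p0031 L26–L48] -/
theorem hElimAlgebra_X_pow_char_pow_add_C_eq_bot (n : ℕ) (c : S) :
    hElimAlgebra k (coeffVec (p ^ n) (Polynomial.X ^ (p ^ n) + Polynomial.C c : S[X])) = ⊥ :=
  hElimAlgebra_X_pow_add_C_eq_bot k (fun _ he1 he => cast_choose_char_pow_eq_zero p n he1 he)
    (pow_ne_zero n (Fact.out : p.Prime).ne_zero) c

/-- In characteristic `p`, every element of `R̄_{Z^{p^n} + c} ⊂ S[W]` is integral over `S`.
[cite: Villamayor2007, Def. 1.42 (1.42.4) p0014 L56–L60] -/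
theorem isIntegral_of_mem_elimAlgebra_X_pow_char_pow_add_C (n : ℕ) (c : S) {q : S[X]}
    (hq : q ∈ elimAlgebra k (coeffVec (p ^ n) (Polynomial.X ^ (p ^ n) + Polynomial.C c : S[X]))) :
    IsIntegral S q :=
  isIntegral_of_mem_elimAlgebra_X_pow_add_C k (fun _ he1 he => cast_choose_char_pow_eq_zero p n he1 he)
    (pow_ne_zero n (Fact.out : p.Prime).ne_zero) c hq

/-- Over a reduced `S` of characteristic `p`: `I_r(Z^{p^n} + c) = 0` for all `r ≥ 1` (Thm. 1.16 (i) with every point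
purely ramified; COROLLARY, ours). [cite: Villamayor2007, Thm. 1.16 (i) p0009 L55–L64] -/
theorem elimIdeal_X_pow_char_pow_add_C_eq_bot [IsReduced S] (n : ℕ) (c : S) {r : ℕ} (hr : 1 ≤ r) :
    elimIdeal k (coeffVec (p ^ n) (Polynomial.X ^ (p ^ n) + Polynomial.C c : S[X])) r = ⊥ :=
  elimIdeal_X_pow_add_C_eq_bot k (fun _ he1 he => cast_choose_char_pow_eq_zero p n he1 he)
    (pow_ne_zero n (Fact.out : p.Prime).ne_zero) c hr

/-- Over a reduced `S` of characteristic `p`: `R̄_{Z^{p^n} + c} = ⊥`. [cite: Villamayor2007, Thm. 1.16 (i) p0009 L55–L64] -/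
theorem elimAlgebra_X_pow_char_pow_add_C_eq_bot [IsReduced S] (n : ℕ) (c : S) :
    elimAlgebra k (coeffVec (p ^ n) (Polynomial.X ^ (p ^ n) + Polynomial.C c : S[X])) = ⊥ :=
  elimAlgebra_X_pow_add_C_eq_bot k (fun _ he1 he => cast_choose_char_pow_eq_zero p n he1 he)
    (pow_ne_zero n (Fact.out : p.Prime).ne_zero) c

/-- Over a reduced `S` of characteristic `p`: `I_r(Z^p + c) = 0` for all `r ≥ 1`. [cite: Villamayor2007, Thm. 1.16 (i) p0009 L55–L64] -/
theorem elimIdeal_X_pow_char_add_C_eq_bot [IsReduced S] (c : S) {r : ℕ} (hr : 1 ≤ r) :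
    elimIdeal k (coeffVec p (Polynomial.X ^ p + Polynomial.C c : S[X])) r = ⊥ :=
  elimIdeal_X_pow_add_C_eq_bot k (fun _ he1 he => cast_choose_char_eq_zero p he1 he)
    (Fact.out : p.Prime).ne_zero c hr

/-- Over a reduced `S` of characteristic `p`: `R̄_{Z^p + c} = ⊥` — together with `hElimAlgebra_X_pow_char_add_C_eq_bot`
the kernel form of «for purely inseparable `f` the elimination of `f` alone sees nothing; one must eliminate the
Diff-algebra» (Example 6.10). [cite: Villamayor2007, Example 6.10 p0031 L26–L48] -/
theorem elimAlgebra_X_pow_char_add_C_eq_bot [IsReduced S] (c : S) :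
    elimAlgebra k (coeffVec p (Polynomial.X ^ p + Polynomial.C c : S[X])) = ⊥ :=
  elimAlgebra_X_pow_add_C_eq_bot k (fun _ he1 he => cast_choose_char_eq_zero p he1 he)
    (Fact.out : p.Prime).ne_zero c

end CharP

end Literature.AlgebraicGeometry.Villamayor2007

end
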